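import Mathlib
import Summits.Ventures.PercRepro2.V2SP
import Summits.Ventures.PercRepro2.Tail2DPathFlip
import Summits.Ventures.PercRepro2.Tail2DPathAvg
import Summits.Ventures.PercRepro2.Tail2DTailAvg
import Summits.Ventures.PercRepro2.Tail2DMaskCC

/-!
# The diagonal masked family is closed under series and single-edge parallel extension
(seat mine-b, cell pub-perc-repro2; MINE-B.md §40.9)

Positions in `ℤ²` (a negative constraint is vacuous — truncation `Int.toNat`): the DIAGONAL masked sums
`D_i(u) = maskD s m u (u + i·(−1,1))` (the antipodal constraint `i` steps bluer along the anti-diagonal) and the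
masked counts `T_i(u)`.  The tail-average position `(a, c | a−1, c+1)` is `D_1((a,c))`.  Under a parallel
extension by ONE free edge the fibre formula of `Tail2DMaskCC.maskD_par` has two terms — the edge red or blue —
and, in `ℤ`-coordinates, they stay on the diagonal family: with the edge not in the mask,
`D_i(u) ↦ D_i(u − (1,0)) + D_i(u − (0,1))`; with the edge in the mask,
`D_i(u) ↦ D_{i−1}(u − (1,0)) + D_{i+1}(u − (0,1)) + T_{i+1}(u − (0,1)) − T_{i−1}(u − (1,0))`.
So the family `{D_i ≤ 0 : i ≥ 1}` together with the COUNT inequality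
`(MT″)  T_{i+1}(w + (1,−1)) ≤ T_{i−1}(w)   (i ≥ 1)`
is closed under `s ↦ s ∥ free` (`maskDZ_par_free`, `maskTZ_par_free`), and (MT″) is closed by itself (the two
fibre terms are compared by two instances of (MT″), the middle terms cancel).  Both families are products under
series composition and hold on the atoms.  The atoms, the class of leaf-parallel patterns and the consequences
((T-AVG) and the whole anti-diagonal unimodality of the tails on that class, unconditionally) are in
`Tail2DLeafPar.lean`.  Census behind it: `D_i ≤ 0` 0 / 124,164 and (MT″) 0 / 148,521 on all 1,499 masked profiles
of the pin-free patterns ≤ 6 edges, every mask; the diagonal cells `(i,i)` are clean on all masked profiles of the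
patterns with 7 and 8 edges (196,720 / 1,882,433 profiles) while the off-diagonal cell `(1,2)` fails at 8 edges (§40.9).
-/

namespace Summit.Ventures.PercRepro2.Tail2D

open V2Closure

section ZCoords

/-- the diagonal masked sum in `ℤ`-coordinates: direct constraint `u`, antipodal constraint `u + i·(−1,1)` -/
def maskDZ (s : SP) (m : s.Conf) (u : ℤ × ℤ) (i : ℤ) : ℤ :=
  maskD s m u.1.toNat u.2.toNat (u.1 - i).toNat (u.2 + i).toNat

/-- the diagonal masked count in `ℤ`-coordinates -/
def maskTZ (s : SP) (m : s.Conf) (u : ℤ × ℤ) (i : ℤ) : ℤ :=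
  maskT s m u.1.toNat u.2.toNat (u.1 - i).toNat (u.2 + i).toNat

/-- the masked count is symmetric under the involution -/
theorem maskT_swap (s : SP) (m : s.Conf) (α γ α' γ' : ℕ) : maskT s m α γ α' γ' = maskT s m α' γ' α γ := by
  unfold maskT
  rw [← Equiv.sum_comp (xorEquiv s m)]
  refine Finset.sum_congr rfl (fun x _ => ?_)
  simp only [xorEquiv, Equiv.coe_fn_mk, xorConf_xorConf]
  by_cases h : (α ≤ s.rLab (xorConf s x m) ∧ γ ≤ s.bLab (xorConf s x m)) ∧ (α' ≤ s.rLab x ∧ γ' ≤ s.bLab x)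
  · rw [if_pos h, if_pos ⟨h.2, h.1⟩]
  · rw [if_neg h, if_neg (fun h' => h ⟨h'.2, h'.1⟩)]

/-- the masked count is non-negative -/
theorem maskT_nonneg (s : SP) (m : s.Conf) (α γ α' γ' : ℕ) : 0 ≤ maskT s m α γ α' γ' := by
  unfold maskT
  exact Finset.sum_nonneg (fun x _ => by split_ifs <;> norm_num)

/-- on the diagonal with parameter `0` the masked sum vanishes (the involution) -/
theorem maskDZ_zero (s : SP) (m : s.Conf) (u : ℤ × ℤ) : maskDZ s m u 0 = 0 := by
  unfold maskDZ
  simp only [sub_zero, add_zero]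
  have h := maskD_swap s m u.1.toNat u.2.toNat u.1.toNat u.2.toNat
  omega

/-- negative parameters are positive ones at the shifted base point -/
theorem maskTZ_neg (s : SP) (m : s.Conf) (u : ℤ × ℤ) (k : ℤ) :
    maskTZ s m u (-k) = maskTZ s m (u.1 + k, u.2 - k) k := by
  unfold maskTZ
  rw [maskT_swap]
  have e1 : (u.1 - -k) = u.1 + k := by ring
  have e2 : (u.2 + -k) = u.2 - k := by ring
  have e3 : (u.1 + k - k) = u.1 := by ring
  have e4 : (u.2 - k + k) = u.2 := by ring
  rw [e1, e2, e3, e4]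

end ZCoords

section Series

/-- the masked count of a series composition is the product of the factors' -/
theorem maskT_ser (s t : SP) (m : (SP.ser s t).Conf) (α γ α' γ' : ℕ) :
    maskT (SP.ser s t) m α γ α' γ' = maskT s m.1 α γ α' γ' * maskT t m.2 α γ α' γ' := by
  unfold maskT
  rw [← sum_mul_sum_int]
  refine Finset.sum_congr rfl (fun x _ => ?_)
  by_cases h : ((α ≤ s.rLab x.1 ∧ γ ≤ s.bLab x.1) ∧ (α' ≤ s.rLab (xorConf s x.1 m.1) ∧ γ' ≤ s.bLab (xorConf s x.1 m.1)))
      ∧ ((α ≤ t.rLab x.2 ∧ γ ≤ t.bLab x.2) ∧ (α' ≤ t.rLab (xorConf t x.2 m.2) ∧ γ' ≤ t.bLab (xorConf t x.2 m.2)))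
  · rw [if_pos ((ser_cond_iff s t m α γ α' γ' x).2 h), if_pos h.1, if_pos h.2]; ring
  · rw [if_neg (fun h' => h ((ser_cond_iff s t m α γ α' γ' x).1 h'))]
    by_cases h1 : (α ≤ s.rLab x.1 ∧ γ ≤ s.bLab x.1) ∧ (α' ≤ s.rLab (xorConf s x.1 m.1) ∧ γ' ≤ s.bLab (xorConf s x.1 m.1))
    · rw [if_pos h1, if_neg (fun h2 => h ⟨h1, h2⟩), mul_zero]
    · rw [if_neg h1, zero_mul]

/-- the diagonal family is closed under series composition -/
theorem maskDZ_ser (s t : SP) (m : (SP.ser s t).Conf) (u : ℤ × ℤ) (i : ℤ)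
    (hs : maskDZ s m.1 u i ≤ 0) (ht : maskDZ t m.2 u i ≤ 0) : maskDZ (SP.ser s t) m u i ≤ 0 :=
  maskD_ser s t m _ _ _ _ hs ht

/-- (MT″) is closed under series composition -/
theorem maskTZ_ser_le (s t : SP) (m : (SP.ser s t).Conf) (u : ℤ × ℤ) (i : ℤ)
    (hs : maskTZ s m.1 (u.1 + 1, u.2 - 1) (i + 1) ≤ maskTZ s m.1 u (i - 1))
    (ht : maskTZ t m.2 (u.1 + 1, u.2 - 1) (i + 1) ≤ maskTZ t m.2 u (i - 1)) :
    maskTZ (SP.ser s t) m (u.1 + 1, u.2 - 1) (i + 1) ≤ maskTZ (SP.ser s t) m u (i - 1) := by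
  unfold maskTZ at *
  rw [maskT_ser, maskT_ser]
  exact mul_le_mul hs ht (maskT_nonneg _ _ _ _ _ _) (le_trans (maskT_nonneg _ _ _ _ _ _) hs)

end Series

section SingleEdge

variable (s : SP)

/-- the masked sum of `s ∥ free` with the edge outside the mask: the two fibres -/
theorem maskD_par_free_false (m : s.Conf) (α γ α' γ' : ℕ) :
    maskD (SP.par s SP.free) (m, false) α γ α' γ'
      = maskD s m (α - 1) γ (α' - 1) γ' + maskD s m α (γ - 1) α' (γ' - 1) := by
  rw [maskD_par]
  refine (Fintype.sum_bool _).trans ?_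
  simp only [xorConf, Bool.xor_false, SP.rLab, SP.bLab, bp_free, if_true, if_false, Bool.false_eq_true,
    Nat.sub_zero, zero_mul, add_zero, sub_self]
  ring

/-- the masked sum of `s ∥ free` with the edge inside the mask: the two fibres and their count terms -/
theorem maskD_par_free_true (m : s.Conf) (α γ α' γ' : ℕ) :
    maskD (SP.par s SP.free) (m, true) α γ α' γ'
      = maskD s m (α - 1) γ α' (γ' - 1) - maskT s m (α - 1) γ α' (γ' - 1)
        + maskD s m α (γ - 1) (α' - 1) γ' + maskT s m α (γ - 1) (α' - 1) γ' := by
  rw [maskD_par]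
  refine (Fintype.sum_bool _).trans ?_
  simp only [xorConf, Bool.xor_true, Bool.not_true, Bool.not_false, SP.rLab, SP.bLab, bp_free, if_true, if_false,
    Bool.false_eq_true, sub_zero, Nat.sub_zero]
  ring

/-- the masked count of `s ∥ t` fibres over the second factor -/
theorem maskT_par (t : SP) (m : (SP.par s t).Conf) (α γ α' γ' : ℕ) :
    maskT (SP.par s t) m α γ α' γ'
      = ∑ y : t.Conf, maskT s m.1 (α - t.rLab y) (γ - t.bLab y) (α' - t.rLab (xorConf t y m.2)) (γ' - t.bLab (xorConf t y m.2)) := by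
  unfold maskT
  rw [Finset.sum_comm, ← Fintype.sum_prod_type']
  refine Finset.sum_congr rfl (fun p _ => ?_)
  obtain ⟨x, y⟩ := p
  by_cases h : (α - t.rLab y ≤ s.rLab x ∧ γ - t.bLab y ≤ s.bLab x)
      ∧ (α' - t.rLab (xorConf t y m.2) ≤ s.rLab (xorConf s x m.1) ∧ γ' - t.bLab (xorConf t y m.2) ≤ s.bLab (xorConf s x m.1))
  · rw [if_pos ((par_cond_iff s t m α γ α' γ' (x, y)).2 h), if_pos h]
  · rw [if_neg (fun h' => h ((par_cond_iff s t m α γ α' γ' (x, y)).1 h')), if_neg h]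

/-- the masked count of `s ∥ free`, edge outside the mask -/
theorem maskT_par_free_false (m : s.Conf) (α γ α' γ' : ℕ) :
    maskT (SP.par s SP.free) (m, false) α γ α' γ'
      = maskT s m (α - 1) γ (α' - 1) γ' + maskT s m α (γ - 1) α' (γ' - 1) := by
  rw [maskT_par]
  refine (Fintype.sum_bool _).trans ?_
  simp only [xorConf, Bool.xor_false, SP.rLab, SP.bLab, if_true, Bool.false_eq_true, if_false, Nat.sub_zero]
  ring

/-- the masked count of `s ∥ free`, edge inside the mask -/
theorem maskT_par_free_true (m : s.Conf) (α γ α' γ' : ℕ) :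
    maskT (SP.par s SP.free) (m, true) α γ α' γ'
      = maskT s m (α - 1) γ α' (γ' - 1) + maskT s m α (γ - 1) (α' - 1) γ' := by
  rw [maskT_par]
  refine (Fintype.sum_bool _).trans ?_
  simp only [xorConf, Bool.xor_true, Bool.not_true, Bool.not_false, SP.rLab, SP.bLab, if_true, Bool.false_eq_true,
    if_false, Nat.sub_zero]
  ring

/-- truncation commutes with the unit shifts -/
theorem toNat_sub_one (z : ℤ) : (z - 1).toNat = z.toNat - 1 := by omega

/-- **the diagonal family in `ℤ`-coordinates under `s ∥ free`, edge outside the mask** -/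
theorem maskDZ_par_free_false (m : s.Conf) (u : ℤ × ℤ) (i : ℤ) :
    maskDZ (SP.par s SP.free) (m, false) u i = maskDZ s m (u.1 - 1, u.2) i + maskDZ s m (u.1, u.2 - 1) i := by
  unfold maskDZ
  rw [maskD_par_free_false]
  have e1 : (u.1 - 1 - i).toNat = (u.1 - i).toNat - 1 := by omega
  have e2 : (u.2 - 1 + i).toNat = (u.2 + i).toNat - 1 := by omega
  rw [e1, e2, toNat_sub_one, toNat_sub_one]

/-- **the diagonal family in `ℤ`-coordinates under `s ∥ free`, edge inside the mask** -/
theorem maskDZ_par_free_true (m : s.Conf) (u : ℤ × ℤ) (i : ℤ) :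
    maskDZ (SP.par s SP.free) (m, true) u i
      = maskDZ s m (u.1 - 1, u.2) (i - 1) - maskTZ s m (u.1 - 1, u.2) (i - 1)
        + maskDZ s m (u.1, u.2 - 1) (i + 1) + maskTZ s m (u.1, u.2 - 1) (i + 1) := by
  unfold maskDZ maskTZ
  rw [maskD_par_free_true]
  have e1 : (u.1 - 1 - (i - 1)).toNat = (u.1 - i).toNat := by congr 1; ring
  have e2 : (u.2 + (i - 1)).toNat = (u.2 + i).toNat - 1 := by omega
  have e3 : (u.1 - (i + 1)).toNat = (u.1 - i).toNat - 1 := by omega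
  have e4 : (u.2 - 1 + (i + 1)).toNat = (u.2 + i).toNat := by congr 1; ring
  rw [e1, e2, e3, e4, toNat_sub_one, toNat_sub_one]

/-- the masked count in `ℤ`-coordinates under `s ∥ free`, edge outside the mask -/
theorem maskTZ_par_free_false (m : s.Conf) (u : ℤ × ℤ) (i : ℤ) :
    maskTZ (SP.par s SP.free) (m, false) u i = maskTZ s m (u.1 - 1, u.2) i + maskTZ s m (u.1, u.2 - 1) i := by
  unfold maskTZ
  rw [maskT_par_free_false]
  have e1 : (u.1 - 1 - i).toNat = (u.1 - i).toNat - 1 := by omega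
  have e2 : (u.2 - 1 + i).toNat = (u.2 + i).toNat - 1 := by omega
  rw [e1, e2, toNat_sub_one, toNat_sub_one]

/-- the masked count in `ℤ`-coordinates under `s ∥ free`, edge inside the mask -/
theorem maskTZ_par_free_true (m : s.Conf) (u : ℤ × ℤ) (i : ℤ) :
    maskTZ (SP.par s SP.free) (m, true) u i
      = maskTZ s m (u.1 - 1, u.2) (i - 1) + maskTZ s m (u.1, u.2 - 1) (i + 1) := by
  unfold maskTZ
  rw [maskT_par_free_true]
  have e1 : (u.1 - 1 - (i - 1)).toNat = (u.1 - i).toNat := by congr 1; ring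
  have e2 : (u.2 + (i - 1)).toNat = (u.2 + i).toNat - 1 := by omega
  have e3 : (u.1 - (i + 1)).toNat = (u.1 - i).toNat - 1 := by omega
  have e4 : (u.2 - 1 + (i + 1)).toNat = (u.2 + i).toNat := by congr 1; ring
  rw [e1, e2, e3, e4, toNat_sub_one, toNat_sub_one]

/-- **the single-edge parallel step of the diagonal family** (given (MT″) for the first factor) -/
theorem maskDZ_par_free
    (hD : ∀ (m : s.Conf) (u : ℤ × ℤ) (i : ℤ), 1 ≤ i → maskDZ s m u i ≤ 0)
    (hT : ∀ (m : s.Conf) (u : ℤ × ℤ) (i : ℤ), 1 ≤ i → maskTZ s m (u.1 + 1, u.2 - 1) (i + 1) ≤ maskTZ s m u (i - 1))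
    (m : (SP.par s SP.free).Conf) (u : ℤ × ℤ) (i : ℤ) (hi : 1 ≤ i) :
    maskDZ (SP.par s SP.free) m u i ≤ 0 := by
  obtain ⟨m₁, m₂⟩ := m
  cases m₂
  · rw [maskDZ_par_free_false]
    have h1 := hD m₁ (u.1 - 1, u.2) i hi
    have h2 := hD m₁ (u.1, u.2 - 1) i hi
    omega
  · rw [maskDZ_par_free_true]
    have h2 := hD m₁ (u.1, u.2 - 1) (i + 1) (by omega)
    have h3 := hT m₁ (u.1 - 1, u.2) i hi
    simp only [sub_add_cancel] at h3
    rcases (by omega : i = 1 ∨ 2 ≤ i) with rfl | hi2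
    · have h1 := maskDZ_zero s m₁ (u.1 - 1, u.2)
      norm_num at h1 h2 h3 ⊢
      omega
    · have h1 := hD m₁ (u.1 - 1, u.2) (i - 1) (by omega)
      omega

/-- **(MT″) under `s ∥ free`** -/
theorem maskTZ_par_free
    (hT : ∀ (m : s.Conf) (u : ℤ × ℤ) (i : ℤ), 1 ≤ i → maskTZ s m (u.1 + 1, u.2 - 1) (i + 1) ≤ maskTZ s m u (i - 1))
    (m : (SP.par s SP.free).Conf) (u : ℤ × ℤ) (i : ℤ) (hi : 1 ≤ i) :
    maskTZ (SP.par s SP.free) m (u.1 + 1, u.2 - 1) (i + 1) ≤ maskTZ (SP.par s SP.free) m u (i - 1) := by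
  obtain ⟨m₁, m₂⟩ := m
  cases m₂
  · rw [maskTZ_par_free_false, maskTZ_par_free_false]
    have h1 := hT m₁ (u.1 - 1, u.2) i hi
    have h2 := hT m₁ (u.1, u.2 - 1) i hi
    dsimp only at h1 h2 ⊢
    norm_num at h1 h2 ⊢
    omega
  · rw [maskTZ_par_free_true, maskTZ_par_free_true]
    dsimp only
    rcases (by omega : i = 1 ∨ 2 ≤ i) with rfl | hi2
    · -- `T_0` at the left base point is `T_1` at the shifted point (the involution)
      have hneg := maskTZ_neg s m₁ (u.1 - 1, u.2) 1
      have h := hT m₁ (u.1, u.2 - 1) 2 (by norm_num)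
      dsimp only at hneg h
      norm_num at h hneg ⊢
      omega
    · have h := hT m₁ (u.1, u.2 - 1) (i + 1) (by omega)
      have h' := hT m₁ (u.1 - 1, u.2) (i - 1) (by omega)
      dsimp only at h h'
      norm_num at h h' ⊢
      omega

end SingleEdge

section Commute

/-- the masked sum is symmetric in the two parallel factors -/
theorem maskD_par_comm (s t : SP) (m : (SP.par s t).Conf) (α γ α' γ' : ℕ) :
    maskD (SP.par s t) m α γ α' γ' = maskD (SP.par t s) (m.2, m.1) α γ α' γ' := by
  unfold maskD
  refine Fintype.sum_equiv (Equiv.prodComm s.Conf t.Conf) _ _ (fun p => ?_)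
  obtain ⟨x, y⟩ := p
  simp only [Equiv.prodComm_apply, Prod.swap_prod_mk]
  have e1 : (SP.par s t).rLab (x, y) = (SP.par t s).rLab (y, x) := by
    show parR s.rLab t.rLab (x, y) = parR t.rLab s.rLab (y, x); simp only [parR]; ring
  have e2 : (SP.par s t).bLab (x, y) = (SP.par t s).bLab (y, x) := by
    show parB s.bLab t.bLab (x, y) = parB t.bLab s.bLab (y, x); simp only [parB]; ring
  have e3 : (SP.par s t).rLab (xorConf (SP.par s t) (x, y) m) = (SP.par t s).rLab (xorConf (SP.par t s) (y, x) (m.2, m.1)) := by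
    show parR s.rLab t.rLab (xorConf s x m.1, xorConf t y m.2) = parR t.rLab s.rLab (xorConf t y m.2, xorConf s x m.1)
    simp only [parR]; ring
  have e4 : (SP.par s t).bLab (xorConf (SP.par s t) (x, y) m) = (SP.par t s).bLab (xorConf (SP.par t s) (y, x) (m.2, m.1)) := by
    show parB s.bLab t.bLab (xorConf s x m.1, xorConf t y m.2) = parB t.bLab s.bLab (xorConf t y m.2, xorConf s x m.1)
    simp only [parB]; ring
  have e5 : bp (SP.par s t) (x, y) = bp (SP.par t s) (y, x) := by rw [bp_par, bp_par]; ring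
  have e6 : bp (SP.par s t) (xorConf (SP.par s t) (x, y) m) = bp (SP.par t s) (xorConf (SP.par t s) (y, x) (m.2, m.1)) := by
    show bp (SP.par s t) (xorConf s x m.1, xorConf t y m.2) = bp (SP.par t s) (xorConf t y m.2, xorConf s x m.1)
    rw [bp_par, bp_par]; ring
  simp only [e1, e2, e3, e4, e5, e6]

/-- the masked count is symmetric in the two parallel factors -/
theorem maskT_par_comm (s t : SP) (m : (SP.par s t).Conf) (α γ α' γ' : ℕ) :
    maskT (SP.par s t) m α γ α' γ' = maskT (SP.par t s) (m.2, m.1) α γ α' γ' := by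
  unfold maskT
  refine Fintype.sum_equiv (Equiv.prodComm s.Conf t.Conf) _ _ (fun p => ?_)
  obtain ⟨x, y⟩ := p
  simp only [Equiv.prodComm_apply, Prod.swap_prod_mk]
  have e1 : (SP.par s t).rLab (x, y) = (SP.par t s).rLab (y, x) := by
    show parR s.rLab t.rLab (x, y) = parR t.rLab s.rLab (y, x); simp only [parR]; ring
  have e2 : (SP.par s t).bLab (x, y) = (SP.par t s).bLab (y, x) := by
    show parB s.bLab t.bLab (x, y) = parB t.bLab s.bLab (y, x); simp only [parB]; ring
  have e3 : (SP.par s t).rLab (xorConf (SP.par s t) (x, y) m) = (SP.par t s).rLab (xorConf (SP.par t s) (y, x) (m.2, m.1)) := by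
    show parR s.rLab t.rLab (xorConf s x m.1, xorConf t y m.2) = parR t.rLab s.rLab (xorConf t y m.2, xorConf s x m.1)
    simp only [parR]; ring
  have e4 : (SP.par s t).bLab (xorConf (SP.par s t) (x, y) m) = (SP.par t s).bLab (xorConf (SP.par t s) (y, x) (m.2, m.1)) := by
    show parB s.bLab t.bLab (xorConf s x m.1, xorConf t y m.2) = parB t.bLab s.bLab (xorConf t y m.2, xorConf s x m.1)
    simp only [parB]; ring
  by_cases h : (α ≤ (SP.par t s).rLab (y, x) ∧ γ ≤ (SP.par t s).bLab (y, x))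
      ∧ (α' ≤ (SP.par t s).rLab (xorConf (SP.par t s) (y, x) (m.2, m.1)) ∧ γ' ≤ (SP.par t s).bLab (xorConf (SP.par t s) (y, x) (m.2, m.1)))
  · rw [if_pos h, if_pos (by rw [e1, e2, e3, e4]; exact h)]
  · rw [if_neg h, if_neg (by rw [e1, e2, e3, e4]; exact h)]

/-- the diagonal masked sum is symmetric in the two parallel factors -/
theorem maskDZ_par_comm (s t : SP) (m : (SP.par s t).Conf) (u : ℤ × ℤ) (i : ℤ) :
    maskDZ (SP.par s t) m u i = maskDZ (SP.par t s) (m.2, m.1) u i := by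
  unfold maskDZ; exact maskD_par_comm s t m _ _ _ _

/-- the diagonal masked count is symmetric in the two parallel factors -/
theorem maskTZ_par_comm (s t : SP) (m : (SP.par s t).Conf) (u : ℤ × ℤ) (i : ℤ) :
    maskTZ (SP.par s t) m u i = maskTZ (SP.par t s) (m.2, m.1) u i := by
  unfold maskTZ; exact maskT_par_comm s t m _ _ _ _

/-- the diagonal family under `free ∥ s` -/
theorem maskDZ_free_par (s : SP)
    (hD : ∀ (m : s.Conf) (u : ℤ × ℤ) (i : ℤ), 1 ≤ i → maskDZ s m u i ≤ 0)
    (hT : ∀ (m : s.Conf) (u : ℤ × ℤ) (i : ℤ), 1 ≤ i → maskTZ s m (u.1 + 1, u.2 - 1) (i + 1) ≤ maskTZ s m u (i - 1))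
    (m : (SP.par SP.free s).Conf) (u : ℤ × ℤ) (i : ℤ) (hi : 1 ≤ i) :
    maskDZ (SP.par SP.free s) m u i ≤ 0 := by
  rw [maskDZ_par_comm]
  exact maskDZ_par_free s hD hT (m.2, m.1) u i hi

/-- (MT″) under `free ∥ s` -/
theorem maskTZ_free_par (s : SP)
    (hT : ∀ (m : s.Conf) (u : ℤ × ℤ) (i : ℤ), 1 ≤ i → maskTZ s m (u.1 + 1, u.2 - 1) (i + 1) ≤ maskTZ s m u (i - 1))
    (m : (SP.par SP.free s).Conf) (u : ℤ × ℤ) (i : ℤ) (hi : 1 ≤ i) :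
    maskTZ (SP.par SP.free s) m (u.1 + 1, u.2 - 1) (i + 1) ≤ maskTZ (SP.par SP.free s) m u (i - 1) := by
  rw [maskTZ_par_comm SP.free s m (u.1 + 1, u.2 - 1) (i + 1), maskTZ_par_comm SP.free s m u (i - 1)]
  exact maskTZ_par_free s hT (m.2, m.1) u i hi

end Commute

end Summit.Ventures.PercRepro2.Tail2D
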